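import Mathlib.GroupTheory.Index
import Mathlib.GroupTheory.Coset.Basic
import Mathlib.Algebra.Order.BigOperators.Group.Finset
import Mathlib.Data.Finset.Max
import Mathlib.Tactic.Ring
import Literature.Combinatorics.Additive.TripleProductProperty
import Literature.Combinatorics.Additive.TripleProductPropertySAT
import HarnessLib

/-!
# Neumann 2011, §4: TPP capacity and subgroups of small index — `β(G) ≤ v³ β(H)`, and
`β(G) ≤ v² |G|` when `G` has an abelian subgroup of index `v`

Topic `Literature/Combinatorics/Additive` (triple product property; companion of
`NeumannTPPInequality.lean`, which holds Observations 2.1 and 3.1 of the same note).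

P. M. Neumann, *A note on the triple product property for subsets of finite groups*, LMS J. Comput.
Math. 14 (2011) 232–237, §4 "Subgroups of small index" (p. 236), verbatim:

> **Observation 4.1.** Let `H` be a subgroup of the finite group `G` and let `v := |G : H|`. Then
> `β(G) ⩽ v³ β(H)`. Consequently, for the TPP ratios we have `ρ(G) ⩽ v² ρ(H)`.
> *Proof.* Let `(S, T, U)` be a TPP triple in `G` with parameters `(m, p, q)` such that
> `β(G) = mpq`. Let the distinct right cosets of `H` in `G` be `H, Hx₂, …, Hx_v`. By Observation 2.1
> we may independently right-translate each of `S, T, U` as necessary and assume that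
> `|S ∩ H| ⩾ |S ∩ Hxᵢ|`, `|T ∩ H| ⩾ |T ∩ Hxᵢ|`, `|U ∩ H| ⩾ |U ∩ Hxᵢ|` for `1 ⩽ i ⩽ v`. Let
> `S₁ := S ∩ H`, `T₁ := T ∩ H`, `U₁ := U ∩ H` […]. Then `(S₁, T₁, U₁)` is a TPP triple of subsets of
> `H` […]. Now `m = |S| = ∑ᵢ |S ∩ Hxᵢ| ⩽ v |S ∩ H|`, that is, `m ⩽ v m₁`. Similarly, `p ⩽ v p₁` and
> `q ⩽ v q₁`. Therefore, `β(G) = mpq ⩽ v³ m₁p₁q₁ ⩽ v³ β(H)`, as required. […]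
> **Corollary 4.2.** If there is an abelian subgroup `H` of index `v` in the finite group `G` (whose
> order, recall, is `n`), then `β(G) ⩽ v² n` and `ρ(G) ⩽ v²`.

(`β(G)` = TPP capacity = the largest `|S||T||U|` over TPP triples of SUBSETS of `G`; the abelian
case `β(H) ≤ |H|` is Cohn–Umans 2003, Lemma 3.1.)

## What is here (all proved; 0 named facts; no capacity function is introduced — the statements
quantify over the TPP triple)

* `Neumann2011.exists_heavy_rightCoset` — for a finite subset `S` and a subgroup `H` of the finite
  group `G` some right coset `Hx` carries at least `|S| / [G:H]` points of `S`
  (`|S| ≤ [G:H] · |S ∩ Hx|`; the pigeonhole step "`m = ∑ᵢ |S ∩ Hxᵢ| ≤ v |S ∩ H|`");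
* `Neumann2011_obs41` — **Observation 4.1**: for every TPP triple `(S, T, U)` of `G` there is a TPP
  triple `(S₁, T₁, U₁)` of subsets of `H` with `|S| ≤ v|S₁|`, `|T| ≤ v|T₁|`, `|U| ≤ v|U₁|`, hence
  `|S||T||U| ≤ v³ |S₁||T₁||U₁|` (`Neumann2011_obs41_card`), i.e. `β(G) ≤ v³ β(H)`;
* `Neumann2011_cor42` — **Corollary 4.2**: if `H` is abelian, `|S||T||U| ≤ v² |G|` for every TPP
  triple of `G`, i.e. `β(G) ≤ v² n` (through `tpp_card_le_of_subset_comm`, the abelian packing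
  bound `|S₁||T₁||U₁| ≤ |H|` for a TPP triple inside a commutative subgroup, CU03 Lemma 3.1).

Translation invariance (Observation 2.1, right translations) is the tree's
`TripleProductProperty.map_mulRight` (`TripleProductPropertySAT.lean`).

## References
* P. M. Neumann, LMS J. Comput. Math. 14 (2011) 232–237, doi 10.1112/S1461157010000288: Obs. 2.1
  (p. 234), Obs. 4.1 and Cor. 4.2 (p. 236). [Neumann2011]
* H. Cohn, C. Umans, FOCS 2003, arXiv:math/0307321, Def. 2.1, Lemma 3.1. [CohnUmans2003]
-/

open scoped BigOperators

namespace Literature.Combinatorics.Additive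

open Finset

variable {G : Type*} [Group G]

namespace Neumann2011

/-- **The pigeonhole step of Obs. 4.1** ("`m = |S| = ∑ᵢ |S ∩ Hxᵢ| ⩽ v |S ∩ H|`" after translating):
some right coset `Hx` of `H` meets the finite set `S` in at least `|S|/[G:H]` points, i.e.
`|S| ≤ [G : H] · |{s ∈ S : s x⁻¹ ∈ H}|`. [cite: Neumann2011, Observation 4.1 (proof)] -/
theorem exists_heavy_rightCoset [Finite G] (H : Subgroup G) [DecidablePred (· ∈ H)] (S : Finset G) :
    ∃ x : G, S.card ≤ H.index * (S.filter (fun s => s * x⁻¹ ∈ H)).card := by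
  classical
  haveI : Fintype (Quotient (QuotientGroup.rightRel H)) := Fintype.ofFinite _
  haveI : Nonempty (Quotient (QuotientGroup.rightRel H)) := ⟨⟦1⟧⟩
  have hcardQ : Fintype.card (Quotient (QuotientGroup.rightRel H)) = H.index := by
    rw [Fintype.card_eq_nat_card,
      Nat.card_congr (QuotientGroup.quotientRightRelEquivQuotientLeftRel H), Subgroup.index]
  obtain ⟨y₀, -, hy₀⟩ := Finset.exists_max_image (Finset.univ : Finset (Quotient (QuotientGroup.rightRel H)))
    (fun y => (S.filter (fun s => Quotient.mk (QuotientGroup.rightRel H) s = y)).card)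
    Finset.univ_nonempty
  obtain ⟨x, rfl⟩ := Quotient.exists_rep y₀
  refine ⟨x, ?_⟩
  have hfib : ∀ s, Quotient.mk (QuotientGroup.rightRel H) s = ⟦x⟧ ↔ s * x⁻¹ ∈ H := by
    intro s
    rw [Quotient.eq, QuotientGroup.rightRel_apply, ← H.inv_mem_iff, mul_inv_rev, inv_inv]
  calc S.card = ∑ y ∈ (Finset.univ : Finset (Quotient (QuotientGroup.rightRel H))),
        (S.filter (fun s => Quotient.mk (QuotientGroup.rightRel H) s = y)).card :=
        Finset.card_eq_sum_card_fiberwise (fun s _ => Finset.mem_coe.2 (Finset.mem_univ _))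
    _ ≤ (Finset.univ : Finset (Quotient (QuotientGroup.rightRel H))).card •
          (S.filter (fun s => Quotient.mk (QuotientGroup.rightRel H) s = ⟦x⟧)).card :=
        Finset.sum_le_card_nsmul _ _ _ (fun y _ => hy₀ y (Finset.mem_univ y))
    _ = H.index * (S.filter (fun s => s * x⁻¹ ∈ H)).card := by
        rw [smul_eq_mul, Finset.card_univ, hcardQ]
        congr 2
        ext s
        simp only [Finset.mem_filter, hfib]

/-- Translating the heavy coset to `H`: `{s x⁻¹ : s ∈ S, s x⁻¹ ∈ H} = (S x⁻¹) ∩ H` has the same size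
as `S ∩ Hx`. [cite: Neumann2011, Observation 4.1 (proof: "we may independently right-translate each
of S, T, U")] -/
theorem card_filter_map_mulRight (H : Subgroup G) [DecidablePred (· ∈ H)] (S : Finset G) (x : G) :
    ((S.map (Equiv.mulRight x⁻¹).toEmbedding).filter (· ∈ H)).card =
      (S.filter (fun s => s * x⁻¹ ∈ H)).card := by
  rw [Finset.filter_map, Finset.card_map]
  congr 1

/-- **Abelian packing bound inside a commutative subgroup** (Cohn–Umans 2003, Lemma 3.1, the case
used in Cor. 4.2): if `S, T, U ⊆ H` satisfy the TPP and the elements of `H` commute, then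
`(s, t, u) ↦ s t u` is injective on `S × T × U` with values in `H`, so `|S||T||U| ≤ |H|`.
[cite: CohnUmans2003, Lemma 3.1] [cite: Neumann2011, Corollary 4.2 (proof)] -/
theorem tpp_card_le_of_subset_comm [Fintype G] (H : Subgroup G) [DecidablePred (· ∈ H)]
    (hcomm : ∀ a ∈ H, ∀ b ∈ H, a * b = b * a) {S T U : Finset G} (h : TripleProductProperty S T U)
    (hS : ∀ s ∈ S, s ∈ H) (hT : ∀ t ∈ T, t ∈ H) (hU : ∀ u ∈ U, u ∈ H) :
    S.card * T.card * U.card ≤ Nat.card H := by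
  classical
  have hcardH : Nat.card H = (Finset.univ.filter (· ∈ H)).card := by
    rw [Nat.card_eq_fintype_card, ← Fintype.card_subtype]
  rw [hcardH, ← Finset.card_product, ← Finset.card_product]
  refine Finset.card_le_card_of_injOn (fun x => x.1.1 * x.1.2 * x.2) ?_ ?_
  · rintro ⟨⟨s, t⟩, u⟩ hx
    simp only [Finset.coe_product, Set.mem_prod, Finset.mem_coe] at hx
    simp only [Finset.coe_filter, Finset.mem_univ, true_and, Set.mem_setOf_eq]
    exact H.mul_mem (H.mul_mem (hS _ hx.1.1) (hT _ hx.1.2)) (hU _ hx.2)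
  · rintro ⟨⟨s, t⟩, u⟩ hx ⟨⟨s', t'⟩, u'⟩ hx' he
    simp only [Finset.coe_product, Set.mem_prod, Finset.mem_coe] at hx hx'
    simp only at he
    -- `s t u = s' t' u'` with all six letters in the commutative `H` gives the TPP word
    -- `s s'⁻¹ · t t'⁻¹ · u u'⁻¹ = 1`
    have hsH := hS _ hx.1.1
    have htH := hT _ hx.1.2
    have huH := hU _ hx.2
    have hs'H := hS _ hx'.1.1
    have ht'H := hT _ hx'.1.2
    have hu'H := hU _ hx'.2
    have c1 : s'⁻¹ * (t * t'⁻¹ * u * u'⁻¹) = (t * t'⁻¹ * u * u'⁻¹) * s'⁻¹ :=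
      hcomm _ (H.inv_mem hs'H) _
        (H.mul_mem (H.mul_mem (H.mul_mem htH (H.inv_mem ht'H)) huH) (H.inv_mem hu'H))
    have c2 : t'⁻¹ * (u * u'⁻¹) = (u * u'⁻¹) * t'⁻¹ :=
      hcomm _ (H.inv_mem ht'H) _ (H.mul_mem huH (H.inv_mem hu'H))
    have hword : s * s'⁻¹ * (t * t'⁻¹) * (u * u'⁻¹) = 1 := by
      have e1 : s * t * u * (s' * t' * u')⁻¹ = 1 := by rw [he, mul_inv_cancel]
      calc s * s'⁻¹ * (t * t'⁻¹) * (u * u'⁻¹)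
          = s * (s'⁻¹ * (t * t'⁻¹ * u * u'⁻¹)) := by group
        _ = s * ((t * t'⁻¹ * u * u'⁻¹) * s'⁻¹) := by rw [c1]
        _ = s * t * (t'⁻¹ * (u * u'⁻¹)) * s'⁻¹ := by group
        _ = s * t * ((u * u'⁻¹) * t'⁻¹) * s'⁻¹ := by rw [c2]
        _ = s * t * u * (s' * t' * u')⁻¹ := by group
        _ = 1 := e1
    obtain ⟨e1, e2, e3⟩ := h s hx.1.1 s' hx'.1.1 t hx.1.2 t' hx'.1.2 u hx.2 u' hx'.2 hword
    simp [e1, e2, e3]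

end Neumann2011

open Neumann2011

/-- **Neumann 2011, Observation 4.1** (`β(G) ≤ v³ β(H)`, stated on the triples): for a subgroup `H`
of index `v` of the finite group `G` and any TPP triple `(S, T, U)` of subsets of `G`, there is a TPP
triple `(S₁, T₁, U₁)` of subsets of `H` with `|S| ≤ v |S₁|`, `|T| ≤ v |T₁|`, `|U| ≤ v |U₁|` — namely
`S₁ = Sa ∩ H`, `T₁ = Tb ∩ H`, `U₁ = Uc ∩ H` for right translates moving a heaviest right coset of each
set onto `H`. [cite: Neumann2011, Observation 4.1] -/
theorem Neumann2011_obs41 [Finite G] (H : Subgroup G) [DecidablePred (· ∈ H)] {S T U : Finset G}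
    (h : TripleProductProperty S T U) :
    ∃ S₁ T₁ U₁ : Finset G, (∀ s ∈ S₁, s ∈ H) ∧ (∀ t ∈ T₁, t ∈ H) ∧ (∀ u ∈ U₁, u ∈ H) ∧
      TripleProductProperty S₁ T₁ U₁ ∧
      S.card ≤ H.index * S₁.card ∧ T.card ≤ H.index * T₁.card ∧ U.card ≤ H.index * U₁.card := by
  obtain ⟨a, ha⟩ := exists_heavy_rightCoset H S
  obtain ⟨b, hb⟩ := exists_heavy_rightCoset H T
  obtain ⟨c, hc⟩ := exists_heavy_rightCoset H U
  refine ⟨(S.map (Equiv.mulRight a⁻¹).toEmbedding).filter (· ∈ H),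
    (T.map (Equiv.mulRight b⁻¹).toEmbedding).filter (· ∈ H),
    (U.map (Equiv.mulRight c⁻¹).toEmbedding).filter (· ∈ H),
    fun s hs => (Finset.mem_filter.1 hs).2, fun t ht => (Finset.mem_filter.1 ht).2,
    fun u hu => (Finset.mem_filter.1 hu).2, ?_, ?_, ?_, ?_⟩
  · exact (h.map_mulRight a⁻¹ b⁻¹ c⁻¹).mono (Finset.filter_subset _ _) (Finset.filter_subset _ _)
      (Finset.filter_subset _ _)
  · rwa [card_filter_map_mulRight]
  · rwa [card_filter_map_mulRight]
  · rwa [card_filter_map_mulRight]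

/-- **Neumann 2011, Observation 4.1, product form**: `|S||T||U| ≤ v³ |S₁||T₁||U₁|` for a TPP triple
`(S₁, T₁, U₁)` inside `H` ("`β(G) = mpq ⩽ v³ m₁p₁q₁ ⩽ v³ β(H)`"). [cite: Neumann2011, Observation 4.1] -/
theorem Neumann2011_obs41_card [Finite G] (H : Subgroup G) [DecidablePred (· ∈ H)] {S T U : Finset G}
    (h : TripleProductProperty S T U) :
    ∃ S₁ T₁ U₁ : Finset G, (∀ s ∈ S₁, s ∈ H) ∧ (∀ t ∈ T₁, t ∈ H) ∧ (∀ u ∈ U₁, u ∈ H) ∧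
      TripleProductProperty S₁ T₁ U₁ ∧
      S.card * T.card * U.card ≤ H.index ^ 3 * (S₁.card * T₁.card * U₁.card) := by
  obtain ⟨S₁, T₁, U₁, hS, hT, hU, h₁, h1, h2, h3⟩ := Neumann2011_obs41 H h
  refine ⟨S₁, T₁, U₁, hS, hT, hU, h₁, ?_⟩
  calc S.card * T.card * U.card
      ≤ H.index * S₁.card * (H.index * T₁.card) * (H.index * U₁.card) :=
        Nat.mul_le_mul (Nat.mul_le_mul h1 h2) h3
    _ = H.index ^ 3 * (S₁.card * T₁.card * U₁.card) := by ring

/-- **Neumann 2011, Corollary 4.2** (`β(G) ≤ v² n`): if the finite group `G` has an abelian subgroup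
`H` of index `v`, then every TPP triple `(S, T, U)` of subsets of `G` has `|S||T||U| ≤ v² |G|`
(Obs. 4.1 and the abelian bound `β(H) ≤ |H|`, `v³ |H| = v² |G|`). [cite: Neumann2011, Corollary 4.2]
[cite: CohnUmans2003, Lemma 3.1] -/
theorem Neumann2011_cor42 [Fintype G] (H : Subgroup G) [DecidablePred (· ∈ H)]
    (hcomm : ∀ a ∈ H, ∀ b ∈ H, a * b = b * a) {S T U : Finset G} (h : TripleProductProperty S T U) :
    S.card * T.card * U.card ≤ H.index ^ 2 * Fintype.card G := by
  obtain ⟨S₁, T₁, U₁, hS, hT, hU, h₁, hle⟩ := Neumann2011_obs41_card H h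
  have hH : S₁.card * T₁.card * U₁.card ≤ Nat.card H := tpp_card_le_of_subset_comm H hcomm h₁ hS hT hU
  have hG : Nat.card H * H.index = Fintype.card G := by
    rw [← Nat.card_eq_fintype_card]; exact H.card_mul_index
  calc S.card * T.card * U.card ≤ H.index ^ 3 * (S₁.card * T₁.card * U₁.card) := hle
    _ ≤ H.index ^ 3 * Nat.card H := Nat.mul_le_mul_left _ hH
    _ = H.index ^ 2 * (Nat.card H * H.index) := by ring
    _ = H.index ^ 2 * Fintype.card G := by rw [hG]

/-- Cor. 4.2 with the commutativity hypothesis as the class `IsMulCommutative H`.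
[cite: Neumann2011, Corollary 4.2] -/
theorem Neumann2011_cor42' [Fintype G] (H : Subgroup G) [DecidablePred (· ∈ H)] [IsMulCommutative H]
    {S T U : Finset G} (h : TripleProductProperty S T U) :
    S.card * T.card * U.card ≤ H.index ^ 2 * Fintype.card G :=
  Neumann2011_cor42 H (fun _ ha _ hb => setLike_mul_comm ha hb) h

end Literature.Combinatorics.Additive
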